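import Literature.RepresentationTheory.KonnoKonno2007.JunctionVacuumSectionLevi
import HarnessLib

/-!
# Two disjoint hyperbolic planes: commuting Siegel frames and plane dilations, and the Levi form of the
# two-parameter boost `a_{(t₁,t₂)} = hypV p₀ q₀ t₁ · hypV p₁ q₁ t₂`

Topic `RepresentationTheory/KonnoKonno2007`; namespace `Literature.RepresentationTheory.KonnoKonno2007.RealDualPair`.
KERNEL ONLY: 0 definitions, 0 records, 0 `Prop`-valued definitions; every statement is a kernel fact about the explicit
matrices `frame R S p q` (the Siegel frame of the plane `{e_p, e_q}`, ★ `RealUnitaryDualPairSL2`), the plane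
dilations `planeDil R S p q c` (★ `JunctionHyperbolicFamily`) and the phase maps `realify`, `leviPhase`
(★ `SchrodingerCovariantUniqueness`, `JunctionVacuumSectionLevi`); public statements are steps of the Levi
factorisation `ω(a_t) = μ(U)⁻¹ ∘ L(δ_t) ∘ μ(U)` of the metaplectic representation along the split torus
[Folland1989, §4.2 (4.24), Prop. (4.39)] for the Cartan decomposition `G = K A K` [Knapp2002, VII §3 Thm. 7.39] and carry
those locators.

For ONE plane, ★ `hypPhase_eq` + ★ `hypPhase_eq_conj_leviPhase` say that the phase map of the boost `(hypV p₀ q₀ t, 1)`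
of `G_∞ = U(P,Q) × U(R,S)` is `realify u₀⁻¹ ∘ leviPhase (δ₀, δ₀⁻¹) ∘ realify u₀` with the Siegel frame
`u₀ = frameU R S p₀ q₀ ∈ U(ℂ^{DPIdx})` and the plane dilation `δ₀ = planeDil R S p₀ q₀ (e^t)`.  For TWO DISJOINT planes
(`p₀ ≠ p₁`, `q₀ ≠ q₁`) we prove that the same holds for the product boost with the COMMON frame `u₀ u₁` and the product
dilation `δ₀ δ₁`:

* §1 disjointness: each frame is the identity off its plane, so the two frames commute (`frame_mul_frame_comm`,
  `frameU_mul_frameU_comm`), the dilations commute (`planeDil_mul_comm`, any planes), and the frame of one plane commutes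
  with the Levi phase map of the other (`realify_frameU_leviPhase_planeDil_comm`, and its inverse-frame form);
* §2 the assembled identity `hypPhase_two_eq_conj_leviPhase`:
  `ι𝕎 (hypV p₀ q₀ t₁ · hypV p₁ q₁ t₂, 1) = realify (u₀u₁)⁻¹ ∘ leviPhase (δ₀δ₁, (δ₀δ₁)⁻¹) ∘ realify (u₀u₁)` on phase space,
  together with the contragredience `had` and the operator-norm continuity `hL` of `t ↦ (δ₀δ₁)⁻¹` — the four soft
  `A`-fields of `Weil1964.LeviKAKInput` for the two-parameter torus (consumer: `LeviKAKInput.junctionTwo`, KAK-U22 (ii)).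

References: [Folland1989] G. B. Folland, *Harmonic Analysis in Phase Space*, Princeton UP 1989, §4.2 (4.24), Prop. (4.39);
[Knapp2002] A. W. Knapp, *Lie Groups Beyond an Introduction*, 2nd ed., VII §3 Thm. 7.39; [KonnoKonno2007] §3.1.
-/

set_option autoImplicit false

noncomputable section

open Matrix Complex
open scoped ComplexConjugate

namespace Literature.RepresentationTheory.KonnoKonno2007

namespace RealDualPair

open Literature.Analysis.SegalBargmann Literature.RepresentationTheory.HeisenbergGroup
open Literature.NumberTheory.Automorphic Literature.NumberTheory.Automorphic.UnitaryGroup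

variable {P Q : Type*} (R S : Type*) [Fintype P] [DecidableEq P] [Fintype Q] [DecidableEq Q] [Fintype R]
  [DecidableEq R] [Fintype S] [DecidableEq S] (p₀ p₁ : P) (q₀ q₁ : Q)

/-! ## 1. Disjoint planes: frames and dilations commute -/

/-- **two Siegel frames of disjoint planes commute on vectors**: `u₀ (u₁ X) = u₁ (u₀ X)` (`p₀ ≠ p₁`, `q₀ ≠ q₁`; each
frame is the identity off its plane). [cite: Folland1989, §4.2 (4.24), Prop. (4.39)] -/
theorem frame_mulVec_frame_mulVec_comm (hp : p₀ ≠ p₁) (hq : q₀ ≠ q₁) (X : DPIdx P Q R S → ℂ) :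
    frame R S p₀ q₀ *ᵥ (frame R S p₁ q₁ *ᵥ X) = frame R S p₁ q₁ *ᵥ (frame R S p₀ q₀ *ᵥ X) := by
  funext k
  rcases k with ((⟨p, r⟩ | ⟨q, s⟩) | (⟨p, s⟩ | ⟨q, r⟩))
  · by_cases h0 : p = p₀
    · simp [frame_mulVec_ll, frame_mulVec_rr, h0, hp, hq]
    · by_cases h1 : p = p₁
      · simp [frame_mulVec_ll, frame_mulVec_rr, h1, hp.symm, hq.symm]
      · simp [frame_mulVec_ll, h0, h1]
  · by_cases h0 : q = q₀
    · simp [frame_mulVec_lr, frame_mulVec_rl, h0, hp, hq]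
    · by_cases h1 : q = q₁
      · simp [frame_mulVec_lr, frame_mulVec_rl, h1, hp.symm, hq.symm]
      · simp [frame_mulVec_lr, h0, h1]
  · by_cases h0 : p = p₀
    · simp [frame_mulVec_rl, frame_mulVec_lr, h0, hp, hq]
    · by_cases h1 : p = p₁
      · simp [frame_mulVec_rl, frame_mulVec_lr, h1, hp.symm, hq.symm]
      · simp [frame_mulVec_rl, h0, h1]
  · by_cases h0 : q = q₀
    · simp [frame_mulVec_rr, frame_mulVec_ll, h0, hp, hq]
    · by_cases h1 : q = q₁
      · simp [frame_mulVec_rr, frame_mulVec_ll, h1, hp.symm, hq.symm]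
      · simp [frame_mulVec_rr, h0, h1]

/-- **two Siegel frames of disjoint planes commute** in `U(ℂ^{DPIdx})`. [cite: Folland1989, §4.2 (4.24), Prop. (4.39)] -/
theorem frameU_mul_frameU_comm (hp : p₀ ≠ p₁) (hq : q₀ ≠ q₁) :
    frameU R S p₀ q₀ * frameU R S p₁ q₁ = frameU R S p₁ q₁ * frameU R S p₀ q₀ := by
  apply Subtype.ext
  change frame R S p₀ q₀ * frame R S p₁ q₁ = frame R S p₁ q₁ * frame R S p₀ q₀
  refine Matrix.ext fun i j => ?_
  have h := congrFun (frame_mulVec_frame_mulVec_comm R S p₀ p₁ q₀ q₁ hp hq (Pi.single j 1)) i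
  rw [Matrix.mulVec_mulVec, Matrix.mulVec_mulVec] at h
  simpa [Matrix.mulVec_single_one] using h

omit [Fintype P] [Fintype Q] [Fintype R] [DecidableEq R] [Fintype S] [DecidableEq S] in
/-- **plane dilations commute** (any two planes; they are diagonal). [cite: Folland1989, §4.2 (4.24)] -/
theorem planeDil_mul_comm (c c' : ℝ) (hc : c ≠ 0) (hc' : c' ≠ 0) :
    planeDil R S p₀ q₀ c hc * planeDil R S p₁ q₁ c' hc' = planeDil R S p₁ q₁ c' hc' * planeDil R S p₀ q₀ c hc :=
  LinearEquiv.ext fun x => funext fun k => by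
    rw [LinearEquiv.mul_apply, LinearEquiv.mul_apply, planeDil_apply, planeDil_apply, planeDil_apply, planeDil_apply]
    ring

omit [Fintype P] [Fintype Q] [Fintype R] [DecidableEq R] [Fintype S] [DecidableEq S] in
/-- the inverse dilations commute too. [cite: Folland1989, §4.2 (4.24)] -/
theorem planeDil_symm_comm (c c' : ℝ) (hc : c ≠ 0) (hc' : c' ≠ 0) (y : DPIdx P Q R S → ℝ) :
    (planeDil R S p₀ q₀ c hc).symm ((planeDil R S p₁ q₁ c' hc').symm y) =
      (planeDil R S p₁ q₁ c' hc').symm ((planeDil R S p₀ q₀ c hc).symm y) := by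
  funext k
  rw [planeDil_symm_apply, planeDil_symm_apply, planeDil_symm_apply, planeDil_symm_apply]
  ring

omit [Fintype P] [Fintype Q] [Fintype R] [DecidableEq R] [Fintype S] [DecidableEq S] in
/-- the dilation weight of the plane `(p₀,q₀)` is `1` at the coordinates of a disjoint plane. [folklore] -/
private theorem dilWt_off (hp : p₀ ≠ p₁) (hq : q₀ ≠ q₁) (c : ℝ) :
    (∀ r : R, dilWt R S p₀ q₀ c (Sum.inl (Sum.inl (p₁, r))) = 1) ∧
      (∀ s : S, dilWt R S p₀ q₀ c (Sum.inl (Sum.inr (q₁, s))) = 1) ∧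
      (∀ s : S, dilWt R S p₀ q₀ c (Sum.inr (Sum.inl (p₁, s))) = 1) ∧
      (∀ r : R, dilWt R S p₀ q₀ c (Sum.inr (Sum.inr (q₁, r))) = 1) := by
  refine ⟨fun r => ?_, fun s => ?_, fun s => ?_, fun r => ?_⟩ <;>
    simp [dilWt, Ne.symm hp, Ne.symm hq]

/-- **the Siegel frame of one plane commutes with the Levi phase map of a disjoint plane**:
`realify u₁ ∘ m(δ₀, δ₀⁻¹) = m(δ₀, δ₀⁻¹) ∘ realify u₁` (`p₀ ≠ p₁`, `q₀ ≠ q₁`). [cite: Folland1989, §4.2 (4.24), Prop. (4.39)] -/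
theorem realify_frameU_leviPhase_planeDil_comm (hp : p₀ ≠ p₁) (hq : q₀ ≠ q₁) (c : ℝ) (hc : c ≠ 0)
    (pq : (DPIdx P Q R S → ℝ) × (DPIdx P Q R S → ℝ)) :
    realify (frameU R S p₁ q₁) (leviPhase (planeDil R S p₀ q₀ c hc) (planeDil R S p₀ q₀ c hc).symm pq) =
      leviPhase (planeDil R S p₀ q₀ c hc) (planeDil R S p₀ q₀ c hc).symm (realify (frameU R S p₁ q₁) pq) := by
  obtain ⟨hll, hlr, hrl, hrr⟩ := dilWt_off R S p₀ p₁ q₀ q₁ hp hq c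
  obtain ⟨hll', hlr', hrl', hrr'⟩ := dilWt_off R S p₀ p₁ q₀ q₁ hp hq c⁻¹
  apply pv_ext
  rw [phasePt_realify, coe_frameU]
  -- the two coordinates of `realify u₁ pq` are the real and imaginary parts of `u₁ (p + iq)`
  have hre : ∀ k, (realify (frameU R S p₁ q₁) pq).1 k = ((frame R S p₁ q₁ *ᵥ phasePt pq.1 pq.2) k).re :=
    fun k => rfl
  have him : ∀ k, (realify (frameU R S p₁ q₁) pq).2 k = ((frame R S p₁ q₁ *ᵥ phasePt pq.1 pq.2) k).im :=
    fun k => rfl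
  -- on the plane of `u₁` the dilation weights are `1`: the dilated point has the same plane-`1` coordinates
  have hZll : ∀ r : R, phasePt (planeDil R S p₀ q₀ c hc pq.1) ((planeDil R S p₀ q₀ c hc).symm pq.2)
      (Sum.inl (Sum.inl (p₁, r))) = phasePt pq.1 pq.2 (Sum.inl (Sum.inl (p₁, r))) := fun r => by
    rw [phasePt_apply, phasePt_apply, planeDil_apply, planeDil_symm_apply, hll, hll', one_mul, one_mul]
  have hZlr : ∀ s : S, phasePt (planeDil R S p₀ q₀ c hc pq.1) ((planeDil R S p₀ q₀ c hc).symm pq.2)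
      (Sum.inl (Sum.inr (q₁, s))) = phasePt pq.1 pq.2 (Sum.inl (Sum.inr (q₁, s))) := fun s => by
    rw [phasePt_apply, phasePt_apply, planeDil_apply, planeDil_symm_apply, hlr, hlr', one_mul, one_mul]
  have hZrl : ∀ s : S, phasePt (planeDil R S p₀ q₀ c hc pq.1) ((planeDil R S p₀ q₀ c hc).symm pq.2)
      (Sum.inr (Sum.inl (p₁, s))) = phasePt pq.1 pq.2 (Sum.inr (Sum.inl (p₁, s))) := fun s => by
    rw [phasePt_apply, phasePt_apply, planeDil_apply, planeDil_symm_apply, hrl, hrl', one_mul, one_mul]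
  have hZrr : ∀ r : R, phasePt (planeDil R S p₀ q₀ c hc pq.1) ((planeDil R S p₀ q₀ c hc).symm pq.2)
      (Sum.inr (Sum.inr (q₁, r))) = phasePt pq.1 pq.2 (Sum.inr (Sum.inr (q₁, r))) := fun r => by
    rw [phasePt_apply, phasePt_apply, planeDil_apply, planeDil_symm_apply, hrr, hrr', one_mul, one_mul]
  -- off the plane of `u₁` the frame is the identity and `re ∕ im` of `p + iq` are `p`, `q`
  have hreZ₀ : ∀ k, (phasePt pq.1 pq.2 k).re = pq.1 k := fun k => by simp [phasePt_apply]
  have himZ₀ : ∀ k, (phasePt pq.1 pq.2 k).im = pq.2 k := fun k => by simp [phasePt_apply]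
  funext k
  simp only [leviPhase_apply]
  rcases k with ((⟨p, r⟩ | ⟨q, s⟩) | (⟨p, s⟩ | ⟨q, r⟩))
  · rw [phasePt_apply (planeDil R S p₀ q₀ c hc (realify (frameU R S p₁ q₁) pq).1), planeDil_apply,
      planeDil_symm_apply, hre, him, frame_mulVec_ll, frame_mulVec_ll]
    by_cases h1 : p = p₁
    · subst h1
      rw [if_pos rfl, if_pos rfl, hZll, hZrr, hll, hll', one_mul, one_mul, Complex.re_add_im]
    · rw [if_neg h1, if_neg h1, hreZ₀, himZ₀, phasePt_apply, planeDil_apply, planeDil_symm_apply]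
  · rw [phasePt_apply (planeDil R S p₀ q₀ c hc (realify (frameU R S p₁ q₁) pq).1), planeDil_apply,
      planeDil_symm_apply, hre, him, frame_mulVec_lr, frame_mulVec_lr]
    by_cases h1 : q = q₁
    · subst h1
      rw [if_pos rfl, if_pos rfl, hZrl, hZlr, hlr, hlr', one_mul, one_mul, Complex.re_add_im]
    · rw [if_neg h1, if_neg h1, hreZ₀, himZ₀, phasePt_apply, planeDil_apply, planeDil_symm_apply]
  · rw [phasePt_apply (planeDil R S p₀ q₀ c hc (realify (frameU R S p₁ q₁) pq).1), planeDil_apply,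
      planeDil_symm_apply, hre, him, frame_mulVec_rl, frame_mulVec_rl]
    by_cases h1 : p = p₁
    · subst h1
      rw [if_pos rfl, if_pos rfl, hZrl, hZlr, hrl, hrl', one_mul, one_mul, Complex.re_add_im]
    · rw [if_neg h1, if_neg h1, hreZ₀, himZ₀, phasePt_apply, planeDil_apply, planeDil_symm_apply]
  · rw [phasePt_apply (planeDil R S p₀ q₀ c hc (realify (frameU R S p₁ q₁) pq).1), planeDil_apply,
      planeDil_symm_apply, hre, him, frame_mulVec_rr, frame_mulVec_rr]
    by_cases h1 : q = q₁
    · subst h1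
      rw [if_pos rfl, if_pos rfl, hZll, hZrr, hrr, hrr', one_mul, one_mul, Complex.re_add_im]
    · rw [if_neg h1, if_neg h1, hreZ₀, himZ₀, phasePt_apply, planeDil_apply, planeDil_symm_apply]

/-- the same with the inverse frame: `realify u₁⁻¹ ∘ m(δ₀, δ₀⁻¹) = m(δ₀, δ₀⁻¹) ∘ realify u₁⁻¹`.
[cite: Folland1989, §4.2 (4.24), Prop. (4.39)] -/
theorem realify_frameU_inv_leviPhase_planeDil_comm (hp : p₀ ≠ p₁) (hq : q₀ ≠ q₁) (c : ℝ) (hc : c ≠ 0)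
    (pq : (DPIdx P Q R S → ℝ) × (DPIdx P Q R S → ℝ)) :
    realify (frameU R S p₁ q₁)⁻¹ (leviPhase (planeDil R S p₀ q₀ c hc) (planeDil R S p₀ q₀ c hc).symm pq) =
      leviPhase (planeDil R S p₀ q₀ c hc) (planeDil R S p₀ q₀ c hc).symm (realify (frameU R S p₁ q₁)⁻¹ pq) := by
  have h := realify_frameU_leviPhase_planeDil_comm R S p₀ p₁ q₀ q₁ hp hq c hc (realify (frameU R S p₁ q₁)⁻¹ pq)
  rw [← realify_mul, mul_inv_cancel, realify_one] at h
  rw [← h, ← realify_mul, inv_mul_cancel, realify_one]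

/-- realifications of the two commuting frames commute. [cite: Folland1989, §4.2 (4.24), Prop. (4.39)] -/
theorem realify_frameU_comm (hp : p₀ ≠ p₁) (hq : q₀ ≠ q₁) (pq : (DPIdx P Q R S → ℝ) × (DPIdx P Q R S → ℝ)) :
    realify (frameU R S p₀ q₀) (realify (frameU R S p₁ q₁) pq) =
      realify (frameU R S p₁ q₁) (realify (frameU R S p₀ q₀) pq) := by
  rw [← realify_mul, frameU_mul_frameU_comm R S p₀ p₁ q₀ q₁ hp hq, realify_mul]

/-- … and so do a frame and the inverse of the other. [cite: Folland1989, §4.2 (4.24), Prop. (4.39)] -/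
theorem realify_frameU_inv_comm (hp : p₀ ≠ p₁) (hq : q₀ ≠ q₁) (pq : (DPIdx P Q R S → ℝ) × (DPIdx P Q R S → ℝ)) :
    realify (frameU R S p₁ q₁)⁻¹ (realify (frameU R S p₀ q₀) pq) =
      realify (frameU R S p₀ q₀) (realify (frameU R S p₁ q₁)⁻¹ pq) := by
  have hc : (frameU R S p₁ q₁)⁻¹ * frameU R S p₀ q₀ = frameU R S p₀ q₀ * (frameU R S p₁ q₁)⁻¹ := by
    rw [inv_mul_eq_iff_eq_mul, ← mul_assoc, ← frameU_mul_frameU_comm R S p₀ p₁ q₀ q₁ hp hq, mul_assoc, mul_inv_cancel,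
      mul_one]
  rw [← realify_mul, hc, realify_mul]

/-- … and the two inverse frames. [cite: Folland1989, §4.2 (4.24), Prop. (4.39)] -/
theorem realify_frameU_inv_inv_comm (hp : p₀ ≠ p₁) (hq : q₀ ≠ q₁)
    (pq : (DPIdx P Q R S → ℝ) × (DPIdx P Q R S → ℝ)) :
    realify (frameU R S p₀ q₀)⁻¹ (realify (frameU R S p₁ q₁)⁻¹ pq) =
      realify (frameU R S p₁ q₁)⁻¹ (realify (frameU R S p₀ q₀)⁻¹ pq) := by
  rw [← realify_mul, ← _root_.mul_inv_rev, ← frameU_mul_frameU_comm R S p₀ p₁ q₀ q₁ hp hq, _root_.mul_inv_rev, realify_mul]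

/-! ## 2. The Levi form of the two-parameter boost -/

omit [DecidableEq R] [DecidableEq S] in
/-- **contragredience of the product dilation**: `(δ₀δ₁) x · (δ₀δ₁)⁻¹ y = x · y`. [cite: Folland1989, §4.2 (4.24)] -/
theorem planeDil_mul_dotProduct_symm (c c' : ℝ) (hc : c ≠ 0) (hc' : c' ≠ 0) (x y : DPIdx P Q R S → ℝ) :
    (planeDil R S p₀ q₀ c hc * planeDil R S p₁ q₁ c' hc') x ⬝ᵥ
        (planeDil R S p₀ q₀ c hc * planeDil R S p₁ q₁ c' hc').symm y = x ⬝ᵥ y := by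
  rw [LinearEquiv.mul_apply, show (planeDil R S p₀ q₀ c hc * planeDil R S p₁ q₁ c' hc').symm y =
      (planeDil R S p₁ q₁ c' hc').symm ((planeDil R S p₀ q₀ c hc).symm y) from rfl,
    ← planeDil_symm_comm R S p₀ p₁ q₀ q₁ c c' hc hc', planeDil_dotProduct_symm, planeDil_dotProduct_symm]

omit [DecidableEq R] [DecidableEq S] in
/-- **operator-norm continuity of `t ↦ (δ₀(e^{t₁}) δ₁(e^{t₂}))⁻¹`.** [cite: Folland1989, §4.2 (4.24)] -/
theorem continuous_planeDil_mul_exp_symm :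
    Continuous fun t : ℝ × ℝ =>
      (((planeDil R S p₀ q₀ (Real.exp t.1) (Real.exp_pos t.1).ne' *
            planeDil R S p₁ q₁ (Real.exp t.2) (Real.exp_pos t.2).ne').symm.toContinuousLinearEquiv :
          (DPIdx P Q R S → ℝ) ≃L[ℝ] (DPIdx P Q R S → ℝ)) : (DPIdx P Q R S → ℝ) →L[ℝ] (DPIdx P Q R S → ℝ)) := by
  have h : (fun t : ℝ × ℝ =>
      (((planeDil R S p₀ q₀ (Real.exp t.1) (Real.exp_pos t.1).ne' *
            planeDil R S p₁ q₁ (Real.exp t.2) (Real.exp_pos t.2).ne').symm.toContinuousLinearEquiv :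
          (DPIdx P Q R S → ℝ) ≃L[ℝ] (DPIdx P Q R S → ℝ)) : (DPIdx P Q R S → ℝ) →L[ℝ] (DPIdx P Q R S → ℝ))) =
      fun t : ℝ × ℝ =>
        ((((planeDil R S p₁ q₁ (Real.exp t.2) (Real.exp_pos t.2).ne').symm.toContinuousLinearEquiv :
            (DPIdx P Q R S → ℝ) ≃L[ℝ] (DPIdx P Q R S → ℝ)) : (DPIdx P Q R S → ℝ) →L[ℝ] (DPIdx P Q R S → ℝ))).comp
          ((((planeDil R S p₀ q₀ (Real.exp t.1) (Real.exp_pos t.1).ne').symm.toContinuousLinearEquiv :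
            (DPIdx P Q R S → ℝ) ≃L[ℝ] (DPIdx P Q R S → ℝ)) : (DPIdx P Q R S → ℝ) →L[ℝ] (DPIdx P Q R S → ℝ))) := by
    funext t
    exact ContinuousLinearMap.ext fun x => rfl
  rw [h]
  exact ((continuous_planeDil_exp_symm R S p₁ q₁).comp continuous_snd).clm_comp
    ((continuous_planeDil_exp_symm R S p₀ q₀).comp continuous_fst)

/-- **the Levi form of the two-parameter boost**: on phase space,
`ι𝕎 (hypV p₀ q₀ t₁ · hypV p₁ q₁ t₂, 1) = realify (u₀u₁)⁻¹ ∘ m(δ₀δ₁, (δ₀δ₁)⁻¹) ∘ realify (u₀u₁)` for disjoint planes —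
the hypothesis `hγA` of `Weil1964.LeviKAKInput` for the common frame `u₀u₁ = frameU p₀ q₀ · frameU p₁ q₁` and the
product dilation. [cite: Folland1989, §4.2 (4.24), Prop. (4.39)] -/
theorem hypPhase_two_eq_conj_leviPhase (hp : p₀ ≠ p₁) (hq : q₀ ≠ q₁) (t : ℝ × ℝ)
    (pq : (DPIdx P Q R S → ℝ) × (DPIdx P Q R S → ℝ)) :
    ((ι𝕎 P Q R S ((hypV p₀ q₀ t.1 * hypV p₁ q₁ t.2 : UForm P Q), (1 : UForm R S))).1 :
        ((DPIdx P Q R S → ℝ) × (DPIdx P Q R S → ℝ)) ≃ₗ[ℝ] ((DPIdx P Q R S → ℝ) × (DPIdx P Q R S → ℝ))) pq =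
      realify (frameU R S p₀ q₀ * frameU R S p₁ q₁)⁻¹
        (leviPhase
          (planeDil R S p₀ q₀ (Real.exp t.1) (Real.exp_pos t.1).ne' * planeDil R S p₁ q₁ (Real.exp t.2) (Real.exp_pos t.2).ne')
          (planeDil R S p₀ q₀ (Real.exp t.1) (Real.exp_pos t.1).ne' *
            planeDil R S p₁ q₁ (Real.exp t.2) (Real.exp_pos t.2).ne').symm
          (realify (frameU R S p₀ q₀ * frameU R S p₁ q₁) pq)) := by
  -- the product boost is the product of the two one-plane boosts of `G_∞`
  have ha : (((hypV p₀ q₀ t.1 * hypV p₁ q₁ t.2 : UForm P Q)), (1 : UForm R S)) =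
      hyp R S p₀ q₀ t.1 * hyp R S p₁ q₁ t.2 := Prod.ext rfl (mul_one _).symm
  -- one plane at a time (★ `hypPhase_eq`, ★ `hypPhase_eq_conj_leviPhase`)
  have e0 : ∀ w : (DPIdx P Q R S → ℝ) × (DPIdx P Q R S → ℝ),
      ((ι𝕎 P Q R S (hyp R S p₀ q₀ t.1)).1 :
          ((DPIdx P Q R S → ℝ) × (DPIdx P Q R S → ℝ)) ≃ₗ[ℝ] ((DPIdx P Q R S → ℝ) × (DPIdx P Q R S → ℝ))) w =
        realify (frameU R S p₀ q₀)⁻¹ (leviPhase (planeDil R S p₀ q₀ (Real.exp t.1) (Real.exp_pos t.1).ne')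
          (planeDil R S p₀ q₀ (Real.exp t.1) (Real.exp_pos t.1).ne').symm (realify (frameU R S p₀ q₀) w)) :=
    fun w => (hypPhase_eq R S p₀ q₀ t.1 w).symm
  have e1 : ∀ w : (DPIdx P Q R S → ℝ) × (DPIdx P Q R S → ℝ),
      ((ι𝕎 P Q R S (hyp R S p₁ q₁ t.2)).1 :
          ((DPIdx P Q R S → ℝ) × (DPIdx P Q R S → ℝ)) ≃ₗ[ℝ] ((DPIdx P Q R S → ℝ) × (DPIdx P Q R S → ℝ))) w =
        realify (frameU R S p₁ q₁)⁻¹ (leviPhase (planeDil R S p₁ q₁ (Real.exp t.2) (Real.exp_pos t.2).ne')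
          (planeDil R S p₁ q₁ (Real.exp t.2) (Real.exp_pos t.2).ne').symm (realify (frameU R S p₁ q₁) w)) :=
    fun w => (hypPhase_eq R S p₁ q₁ t.2 w).symm
  -- the product dilation acts as the composite of the two (commuting) one-plane Levi maps
  have eL : ∀ w : (DPIdx P Q R S → ℝ) × (DPIdx P Q R S → ℝ),
      leviPhase
          (planeDil R S p₀ q₀ (Real.exp t.1) (Real.exp_pos t.1).ne' * planeDil R S p₁ q₁ (Real.exp t.2) (Real.exp_pos t.2).ne')
          (planeDil R S p₀ q₀ (Real.exp t.1) (Real.exp_pos t.1).ne' *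
            planeDil R S p₁ q₁ (Real.exp t.2) (Real.exp_pos t.2).ne').symm w =
        leviPhase (planeDil R S p₀ q₀ (Real.exp t.1) (Real.exp_pos t.1).ne')
            (planeDil R S p₀ q₀ (Real.exp t.1) (Real.exp_pos t.1).ne').symm
          (leviPhase (planeDil R S p₁ q₁ (Real.exp t.2) (Real.exp_pos t.2).ne')
            (planeDil R S p₁ q₁ (Real.exp t.2) (Real.exp_pos t.2).ne').symm w) := fun w => by
    refine Prod.ext rfl ?_
    show (planeDil R S p₁ q₁ (Real.exp t.2) (Real.exp_pos t.2).ne').symm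
        ((planeDil R S p₀ q₀ (Real.exp t.1) (Real.exp_pos t.1).ne').symm w.2) =
      (planeDil R S p₀ q₀ (Real.exp t.1) (Real.exp_pos t.1).ne').symm
        ((planeDil R S p₁ q₁ (Real.exp t.2) (Real.exp_pos t.2).ne').symm w.2)
    exact planeDil_symm_comm R S p₁ p₀ q₁ q₀ _ _ _ _ w.2
  rw [ha, map_mul]
  change ((ι𝕎 P Q R S (hyp R S p₀ q₀ t.1)).1 :
        ((DPIdx P Q R S → ℝ) × (DPIdx P Q R S → ℝ)) ≃ₗ[ℝ] ((DPIdx P Q R S → ℝ) × (DPIdx P Q R S → ℝ)))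
      (((ι𝕎 P Q R S (hyp R S p₁ q₁ t.2)).1 :
        ((DPIdx P Q R S → ℝ) × (DPIdx P Q R S → ℝ)) ≃ₗ[ℝ] ((DPIdx P Q R S → ℝ) × (DPIdx P Q R S → ℝ))) pq) = _
  rw [e0, e1, _root_.mul_inv_rev, realify_mul, realify_mul, eL]
  -- both sides are words in `realify u₀^{±1}`, `realify u₁^{±1}`, `m(δ₀)`, `m(δ₁)`; commute across the planes
  rw [← realify_frameU_inv_comm R S p₀ p₁ q₀ q₁ hp hq, ← realify_frameU_inv_leviPhase_planeDil_comm R S p₀ p₁ q₀ q₁ hp hq,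
    realify_frameU_inv_inv_comm R S p₀ p₁ q₀ q₁ hp hq,
    realify_frameU_leviPhase_planeDil_comm R S p₁ p₀ q₁ q₀ (Ne.symm hp) (Ne.symm hq),
    realify_frameU_comm R S p₀ p₁ q₀ q₁ hp hq]

end RealDualPair

end Literature.RepresentationTheory.KonnoKonno2007

end
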